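import Literature.MathematicalPhysics.QuantumLattice.LatticeGaugeDLRGibbsProofs
import Literature.MathematicalPhysics.QuantumFieldTheory.PlaquetteWeightTorusSpecification
import Literature.MathematicalPhysics.QuantumFieldTheory.Balaban1983to89.StrongCouplingTorusWindow
import HarnessLib

/-!
# Venture YMGap — track (c) «DS», Route X brick X2: the `ℤ^d` finite-volume kernel at a periodic
# boundary condition IS the torus weight-specification kernel (kernel transfer `ℤ^d ↔ (ℤ/L)^d`)

HONEST FRAMING: venture file (cell `pub-ymgap`), lattice bookkeeping only: an identity between two
finite-volume Gibbs KERNELS of lattice gauge theory — the infinite-lattice Yang–Mills specification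
`ymSpecification ρ β` (Literature `LatticeGaugeDLR`) and the torus weight specification
`torusWeightSpec v` (Literature `PlaquetteWeightTorusSpecification`) with the plaquette weight
`v = exp(−β (N − Re tr ρ ·))` — when the boundary condition on `ℤ^d` is the periodic lift of a
torus configuration and the torus is large enough that the volume, the support of the observable
and the plaquettes touching the volume inject into it. No estimate, no clustering, no continuum or
mass-gap statement. It is the one «transfer» step of the cell's Route X
(`HOME/ds/ds3/UNIQUENESS-K-SCOPE.md` §4): the two-boundary-condition window comparison is run on a
big torus (where Lemma G is a kernel theorem) and carried to `ℤ^4` through this identity.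

The proof re-packages, as a standalone identity, the internals of the tree's
`LatticeGaugeDLRGibbsProofs.wilsonExpectation_toTorusObservable_eq` (near/far split of the torus
action, resampling/reindexing of product Haar measures, lifting a resampled torus configuration is
gluing): both sides equal `(∫ F(lift(W_Λ V)) e^{a(W_Λ V)} dW) / (∫ e^{a(W_Λ V)} dW)` with
`a = −β S_Λ ∘ torusLift` the near part of the torus energy; on the torus side the far part is
constant in the resampled coordinates and cancels in the tilt.

References: Georgii 2011, Def. 2.9 / Prop. 2.5; Friedli–Velenik 2017, Lemma 6.7 and the remark
on periodic boundary conditions before Exercise 6.14; Seiler LNP 159 Ch. 2.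
-/

noncomputable section

open MeasureTheory Filter Topology Finset Function
open Literature.MathematicalPhysics
open Literature.Probability.LatticeModels
open Literature.MathematicalPhysics.QuantumLattice
open Literature.MathematicalPhysics.QuantumFieldTheory (torusWeightSpec torusLogWeight)
open Literature.MathematicalPhysics.QuantumFieldTheory.Balaban1983to89.StrongCouplingTorusWindow
  (wilsonPlaqWeight continuous_wilsonPlaqWeight log_wilsonPlaqWeight)

namespace Summit.Ventures.YMGap.KernelTransfer

/-! ### Resampling form of glued product-Haar integrals on the torus (no group structure needed) -/

section Resampling

variable {d : ℕ} {G : Type*}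

/-- Gluing the coordinates of a full torus configuration `W` over `Λ'` into `V` is `Λ'.piecewise W V`.
[folklore] -/
theorem glueWith_restrict_eq_piecewise {L : ℕ} (Λ' : Finset (QuantumFieldTheory.Edge d L))
    (W V : QuantumFieldTheory.GaugeConfig d L G) :
    glueWith Λ' (fun k : ↥Λ' => W (k : QuantumFieldTheory.Edge d L)) V = Λ'.piecewise W V := by
  classical
  funext e
  by_cases he : e ∈ Λ'
  · rw [glueWith_apply_mem _ _ _ he, Finset.piecewise_eq_of_mem _ _ _ he]
  · rw [glueWith_apply_not_mem _ _ _ he, Finset.piecewise_eq_of_notMem _ _ _ he]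

variable [MeasurableSpace G]

/-- **Fibre integrals in resampling form**: for measurable `Φ` and a probability measure `ν` on `G`,
`∫ Φ(glueWith Λ' ζ V) dν^{Λ'}(ζ) = ∫ Φ(Λ'.piecewise W V) dν^{edges}(W)` (reindexing a product
probability measure along the injection `Λ' ↪ edges`). [folklore] -/
theorem integral_glueWith_eq_integral_piecewise {L : ℕ} [NeZero L] (ν : Measure G)
    [IsProbabilityMeasure ν] (Λ' : Finset (QuantumFieldTheory.Edge d L))
    (V : QuantumFieldTheory.GaugeConfig d L G) {Φ : QuantumFieldTheory.GaugeConfig d L G → ℝ}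
    (hΦ : Measurable Φ) :
    ∫ ζ, Φ (glueWith Λ' ζ V) ∂(Measure.pi fun _ : ↥Λ' => ν) =
      ∫ W, Φ (Λ'.piecewise W V) ∂(Measure.pi fun _ : QuantumFieldTheory.Edge d L => ν) := by
  have hτ : Function.Injective fun k : ↥Λ' => (k : QuantumFieldTheory.Edge d L) :=
    Subtype.val_injective
  have hm : Measurable fun (W : QuantumFieldTheory.GaugeConfig d L G) (k : ↥Λ') =>
      W (k : QuantumFieldTheory.Edge d L) :=
    measurable_pi_iff.2 fun k => measurable_pi_apply _
  rw [← pi_map_comp_injective ν hτ, integral_map hm.aemeasurable]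
  · exact congrArg _ (funext fun W => by rw [glueWith_restrict_eq_piecewise])
  · exact (hΦ.comp (measurable_glueWith Λ' V)).aestronglyMeasurable

end Resampling

variable {d N : ℕ} {G : Type*} [Group G] [TopologicalSpace G] [IsTopologicalGroup G]
  [CompactSpace G] [MeasurableSpace G] [BorelSpace G] [SecondCountableTopology G]
  (ρ : G →* Matrix (Fin N) (Fin N) ℂ)

omit [TopologicalSpace G] [IsTopologicalGroup G] [CompactSpace G] [MeasurableSpace G] [BorelSpace G]
  [SecondCountableTopology G] in
/-- The torus log-weight of a plaquette weight `v` with `log v = −β (N − Re tr ρ ·)` is `−β` times the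
torus Wilson action density summed over all plaquettes: `∑_q log v(U_q) = ∑_q −β (N − Re tr ρ(U_q))`.
[folklore] -/
theorem torusLogWeight_of_log_eq {L : ℕ} [NeZero L] {β : ℝ} {v : G → ℝ}
    (hlog : ∀ g, Real.log (v g) = -(β * ((N : ℝ) - (ρ g).trace.re)))
    (U : QuantumFieldTheory.GaugeConfig d L G) :
    torusLogWeight (d := d) (L := L) v U =
      ∑ q : QuantumFieldTheory.Plaquette d L,
        -(β * ((N : ℝ) - (ρ (QuantumFieldTheory.plaquetteHolonomy U q.1 q.2.1.1 q.2.1.2)).trace.re)) := by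
  unfold torusLogWeight
  exact Finset.sum_congr rfl fun q _ => hlog _

/-- **Integral against the torus weight kernel, resampling form**: for bounded measurable `f`,
`∫ f dγ^{torus}_{Λ'}(· | V) = (∫ f(W_Λ' V) e^{E(W_Λ' V)} dW) / (∫ e^{E(W_Λ' V)} dW)`,
`E = torusLogWeight v`, `W_Λ' V = Λ'.piecewise W V`, `dW` = product Haar on all torus edges.
[folklore] -/
theorem integral_torusWeightSpec_eq_piecewise {L : ℕ} [NeZero L] {v : G → ℝ} (hv : Continuous v)
    (Λ' : Finset (QuantumFieldTheory.Edge d L)) (V : QuantumFieldTheory.GaugeConfig d L G)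
    {f : QuantumFieldTheory.GaugeConfig d L G → ℝ} (hf : Measurable f) :
    ∫ U, f U ∂(torusWeightSpec (d := d) (L := L) v Λ' V) =
      (∫ W, f (Λ'.piecewise W V) * Real.exp (torusLogWeight v (Λ'.piecewise W V))
          ∂(Measure.pi fun _ : QuantumFieldTheory.Edge d L => QuantumFieldTheory.haarProbability G)) /
        ∫ W, Real.exp (torusLogWeight v (Λ'.piecewise W V))
          ∂(Measure.pi fun _ : QuantumFieldTheory.Edge d L => QuantumFieldTheory.haarProbability G) := by
  have hE : Measurable (torusLogWeight (d := d) (L := L) v) :=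
    Literature.MathematicalPhysics.QuantumFieldTheory.measurable_torusLogWeight hv
  set Z : ℝ := ∫ W, Real.exp (torusLogWeight v (Λ'.piecewise W V))
    ∂(Measure.pi fun _ : QuantumFieldTheory.Edge d L => QuantumFieldTheory.haarProbability G) with hZ
  -- the normaliser of the tilt, in resampling form
  have hnorm : ∫ U, Real.exp (torusLogWeight v U)
      ∂(((Measure.pi fun _ : ↥Λ' => QuantumFieldTheory.haarProbability G)).map (glueWith Λ' · V)) = Z := by
    rw [integral_map (f := fun U => Real.exp (torusLogWeight v U))
      (measurable_glueWith Λ' V).aemeasurable (Real.measurable_exp.comp hE).aestronglyMeasurable, hZ]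
    exact integral_glueWith_eq_integral_piecewise (Φ := fun U => Real.exp (torusLogWeight v U)) _ Λ' V
      (Real.measurable_exp.comp hE)
  unfold torusWeightSpec
  rw [integral_tilted, hnorm,
    integral_map (f := fun U => (Real.exp (torusLogWeight v U) / Z) • f U)
      (measurable_glueWith Λ' V).aemeasurable
      ((((Real.measurable_exp.comp hE).div_const Z).smul hf)).aestronglyMeasurable]
  have hrw : (fun ζ : ↥Λ' → G => (Real.exp (torusLogWeight v (glueWith Λ' ζ V)) / Z) •
        f (glueWith Λ' ζ V)) =
      fun ζ => (fun U => f U * Real.exp (torusLogWeight v U) / Z) (glueWith Λ' ζ V) := by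
    funext ζ; simp only [smul_eq_mul]; ring
  rw [hrw, integral_glueWith_eq_integral_piecewise
    (Φ := fun U => f U * Real.exp (torusLogWeight v U) / Z) _ Λ' V
    ((hf.mul (Real.measurable_exp.comp hE)).div_const _), integral_div]

/-- **KERNEL TRANSFER `ℤ^d ↔ (ℤ/L)^d`.** Let `F` be a measurable cylinder observable on `ℤ^d` with
support `S₀`, `Λ` a finite edge set, and `L` so large that reduction mod `L` is injective on the base
points of `Λ ∪ S₀ ∪ ∂Λ` (`∂Λ` = edges of the plaquettes touching `Λ`). Then for EVERY torus
configuration `V`, the `ℤ^d` Yang–Mills kernel of `Λ` at the periodic boundary condition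
`torusLift L V`, applied to `F`, equals the torus weight-specification kernel of the projected volume
`Λ.image (torusEdge L)` at `V`, applied to `F ∘ torusLift L`, for any continuous plaquette weight `v`
with `log v = −β(N − Re tr ρ ·)`:
`∫ F dγ^{ℤ^d}_Λ(· | torusLift L V) = ∫ (F ∘ torusLift L) dγ^{torus}_{proj Λ}(· | V)`.
(Every `ℤ^d` boundary condition is of this form as far as the kernel is concerned: it reads only
the edges of `∂Λ`, `dependsOn_integral_ymSpecification`.) [folklore] -/
theorem integral_ymSpecification_torusLift_eq (hρ : Continuous ρ) {β : ℝ} {v : G → ℝ}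
    (hv : Continuous v) (hlog : ∀ g, Real.log (v g) = -(β * ((N : ℝ) - (ρ g).trace.re)))
    (Λ : Finset (ZdEdge d)) {F : LGConfig d G → ℝ} (hF : Measurable F) {S₀ : Finset (ZdEdge d)}
    (hFS : IsCylinder F S₀) {L : ℕ} [NeZero L]
    (hL : Set.InjOn (Torus.proj L)
      ((Λ ∪ S₀ ∪ (plaquettesTouching Λ).biUnion plaquetteEdges).image Prod.fst : Set (Site d)))
    (V : QuantumFieldTheory.GaugeConfig d L G) :
    ∫ U, F U ∂(ymSpecification ρ β Λ (torusLift L V)) =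
      ∫ W, toTorusObservable L F W
        ∂(torusWeightSpec (d := d) (L := L) v (Λ.image (torusEdge L)) V) := by
  classical
  -- the relevant finite edge set `T` and the injectivity consequences of `hL`
  have hΛT : Λ ⊆ Λ ∪ S₀ ∪ (plaquettesTouching Λ).biUnion plaquetteEdges :=
    (subset_union_left).trans subset_union_left
  have hS₀T : S₀ ⊆ Λ ∪ S₀ ∪ (plaquettesTouching Λ).biUnion plaquetteEdges :=
    (subset_union_right).trans subset_union_left
  have hPT : (plaquettesTouching Λ).biUnion plaquetteEdges ⊆
      Λ ∪ S₀ ∪ (plaquettesTouching Λ).biUnion plaquetteEdges := subset_union_right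
  have hTinj := injOn_torusEdge hL
  have hPinj := injOn_projPlaquette (image_subset_image hPT) hL
  -- near and far parts of the torus action
  set a : QuantumFieldTheory.GaugeConfig d L G → ℝ := fun V =>
    -β * ∑ q ∈ (plaquettesTouching Λ).image
        (fun p : ZdPlaquette d => ((Torus.proj L p.1, p.2) : QuantumFieldTheory.Plaquette d L)),
      ((N : ℝ) - (ρ (QuantumFieldTheory.plaquetteHolonomy V q.1 q.2.1.1 q.2.1.2)).trace.re)
    with ha_def
  set b : QuantumFieldTheory.GaugeConfig d L G → ℝ := fun V =>
    -β * ∑ q ∈ ((plaquettesTouching Λ).image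
        (fun p : ZdPlaquette d => ((Torus.proj L p.1, p.2) : QuantumFieldTheory.Plaquette d L)))ᶜ,
      ((N : ℝ) - (ρ (QuantumFieldTheory.plaquetteHolonomy V q.1 q.2.1.1 q.2.1.2)).trace.re)
    with hb_def
  have hab : ∀ V, torusLogWeight (d := d) (L := L) v V = a V + b V := fun V => by
    rw [torusLogWeight_of_log_eq ρ hlog, ← Finset.sum_add_sum_compl ((plaquettesTouching Λ).image
      (fun p : ZdPlaquette d => ((Torus.proj L p.1, p.2) : QuantumFieldTheory.Plaquette d L)))]
    simp only [ha_def, hb_def, neg_mul, Finset.mul_sum, Finset.sum_neg_distrib]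
  have ha : ∀ V, a V = -β * wilsonBoundaryAction ρ Λ (torusLift L V) := fun V => by
    simp only [ha_def, sum_image_proj_plaquetteTerm ρ hPinj V]
  have hb : ∀ W V, b ((Λ.image (torusEdge L)).piecewise W V) = b V := fun W V => by
    simp only [hb_def]
    congr 1
    refine Finset.sum_congr rfl fun q hq => ?_
    rw [plaquetteHolonomy_piecewise_of_ne (fun p hp h => (Finset.mem_compl.1 hq)
      (Finset.mem_image.2 ⟨p, hp, h⟩)) W V]
  -- transfer of the fibre integrals from `G^Λ` to the torus
  have hτ : Function.Injective fun e : ↥Λ => torusEdge L (e : ZdEdge d) := fun e₁ e₂ h =>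
    Subtype.ext (hTinj (hΛT e₁.2) (hΛT e₂.2) h)
  have transfer : ∀ Φ : LGConfig d G → ℝ, Measurable Φ →
      DependsOn Φ ↑(Λ ∪ S₀ ∪ (plaquettesTouching Λ).biUnion plaquetteEdges) →
      ∀ V : QuantumFieldTheory.GaugeConfig d L G,
        ∫ ζ, Φ (glueWith Λ ζ (torusLift L V))
            ∂(Measure.pi fun _ : ↥Λ => QuantumFieldTheory.haarProbability G) =
          ∫ W, Φ (torusLift L ((Λ.image (torusEdge L)).piecewise W V))
            ∂(Measure.pi fun _ : QuantumFieldTheory.Edge d L =>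
              QuantumFieldTheory.haarProbability G) := by
    intro Φ hΦm hΦT V
    have hm : Measurable fun (W : QuantumFieldTheory.GaugeConfig d L G) (e : ↥Λ) =>
        W (torusEdge L (e : ZdEdge d)) :=
      measurable_pi_iff.2 fun e => measurable_pi_apply _
    have hmeas : Measurable fun ζ : ↥Λ → G => Φ (glueWith Λ ζ (torusLift L V)) :=
      hΦm.comp (measurable_glueWith Λ _)
    rw [← pi_map_comp_injective (QuantumFieldTheory.haarProbability G) hτ,
      integral_map hm.aemeasurable hmeas.aestronglyMeasurable]
    refine congrArg _ (funext fun W => hΦT fun e he => ?_)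
    exact (torusLift_piecewise_apply hΛT hTinj W V he).symm
  -- locality of the two fibre integrands
  have hST : DependsOn (wilsonBoundaryAction (G := G) ρ Λ)
      ↑(Λ ∪ S₀ ∪ (plaquettesTouching Λ).biUnion plaquetteEdges) :=
    (isCylinder_wilsonBoundaryAction_holds (G := G) ρ Λ).mono (Finset.coe_subset.2 hPT)
  have hFT : DependsOn F ↑(Λ ∪ S₀ ∪ (plaquettesTouching Λ).biUnion plaquetteEdges) :=
    hFS.mono (Finset.coe_subset.2 hS₀T)
  have hwm : Measurable fun U : LGConfig d G => Real.exp (-β * wilsonBoundaryAction ρ Λ U) :=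
    (Real.continuous_exp.comp (continuous_const.mul (continuous_wilsonBoundaryAction ρ hρ Λ))).measurable
  -- the `ℤ^d` side, computed on the torus
  have lhs : ∫ U, F U ∂(ymSpecification ρ β Λ (torusLift L V)) =
      (∫ W, F (torusLift L ((Λ.image (torusEdge L)).piecewise W V)) *
          Real.exp (a ((Λ.image (torusEdge L)).piecewise W V))
          ∂(Measure.pi fun _ : QuantumFieldTheory.Edge d L => QuantumFieldTheory.haarProbability G)) /
        ∫ W, Real.exp (a ((Λ.image (torusEdge L)).piecewise W V))
          ∂(Measure.pi fun _ : QuantumFieldTheory.Edge d L => QuantumFieldTheory.haarProbability G) := by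
    rw [integral_ymSpecification ρ hρ β Λ hF,
      transfer (fun U => F U * Real.exp (-β * wilsonBoundaryAction ρ Λ U)) (hF.mul hwm)
        (fun x y h => by simp only [hFT h, hST h]),
      transfer (fun U => Real.exp (-β * wilsonBoundaryAction ρ Λ U)) hwm
        (fun x y h => by simp only [hST h])]
    simp only [ha]
  -- the torus side
  have rhs := integral_torusWeightSpec_eq_piecewise (d := d) (L := L) hv (Λ.image (torusEdge L)) V
    (f := toTorusObservable L F) (hF.comp (continuous_torusLift L).measurable)
  rw [lhs, rhs]
  -- cancel the far part `e^{b V}`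
  simp only [toTorusObservable_apply, hab, hb, Real.exp_add]
  have hbV : Real.exp (b V) ≠ 0 := (Real.exp_pos _).ne'
  have h1 : ∫ W, F (torusLift L ((Λ.image (torusEdge L)).piecewise W V)) *
        (Real.exp (a ((Λ.image (torusEdge L)).piecewise W V)) * Real.exp (b V))
        ∂(Measure.pi fun _ : QuantumFieldTheory.Edge d L => QuantumFieldTheory.haarProbability G) =
      (∫ W, F (torusLift L ((Λ.image (torusEdge L)).piecewise W V)) *
        Real.exp (a ((Λ.image (torusEdge L)).piecewise W V))
        ∂(Measure.pi fun _ : QuantumFieldTheory.Edge d L => QuantumFieldTheory.haarProbability G)) *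
        Real.exp (b V) := by
    rw [← integral_mul_const]
    exact integral_congr_ae (ae_of_all _ fun W => by ring)
  have h2 : ∫ W, Real.exp (a ((Λ.image (torusEdge L)).piecewise W V)) * Real.exp (b V)
        ∂(Measure.pi fun _ : QuantumFieldTheory.Edge d L => QuantumFieldTheory.haarProbability G) =
      (∫ W, Real.exp (a ((Λ.image (torusEdge L)).piecewise W V))
        ∂(Measure.pi fun _ : QuantumFieldTheory.Edge d L => QuantumFieldTheory.haarProbability G)) *
        Real.exp (b V) := integral_mul_const _ _
  rw [h1, h2, mul_div_mul_right _ _ hbV]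

/-- **Kernel transfer for `SU(N)` lattice Yang–Mills in the fundamental representation** (the case
used by the cell: `SU(2)`, `d = 4`, Wilson coupling `β_W`, tree coupling `β = β_W/2`): the `ℤ^d`
kernel `ymSpecification (fundamentalRep (Fin N)) β Λ` at a periodic boundary condition, on a
measurable cylinder observable, is the torus kernel `torusWeightSpec (wilsonPlaqWeight N β)` of the
projected volume on the transplanted observable — the specification whose vertex-star window bound
`DSWindow.StarWindowBound` the cell's Lemma G establishes. [folklore] -/
theorem integral_ymSpecification_torusLift_eq_wilson {N : ℕ}
    {β : ℝ} (Λ : Finset (ZdEdge d))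
    {F : LGConfig d (Matrix.specialUnitaryGroup (Fin N) ℂ) → ℝ} (hF : Measurable F)
    {S₀ : Finset (ZdEdge d)} (hFS : IsCylinder F S₀) {L : ℕ} [NeZero L]
    (hL : Set.InjOn (Torus.proj L)
      ((Λ ∪ S₀ ∪ (plaquettesTouching Λ).biUnion plaquetteEdges).image Prod.fst : Set (Site d)))
    (V : QuantumFieldTheory.GaugeConfig d L (Matrix.specialUnitaryGroup (Fin N) ℂ)) :
    ∫ U, F U ∂(ymSpecification (fundamentalRep (Fin N)) β Λ (torusLift L V)) =
      ∫ W, toTorusObservable L F W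
        ∂(torusWeightSpec (d := d) (L := L)
          (wilsonPlaqWeight N β) (Λ.image (torusEdge L)) V) := by
  haveI : SecondCountableTopology (Matrix (Fin N) (Fin N) ℂ) :=
    inferInstanceAs (SecondCountableTopology (Fin N → Fin N → ℂ))
  haveI : SecondCountableTopology (Matrix.specialUnitaryGroup (Fin N) ℂ) :=
    Topology.IsEmbedding.subtypeVal.secondCountableTopology
  exact integral_ymSpecification_torusLift_eq (fundamentalRep (Fin N)) continuous_subtype_val
    (continuous_wilsonPlaqWeight (N := N) β)
    (fun g => by
      rw [log_wilsonPlaqWeight, fundamentalRep_apply])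
    Λ hF hFS hL V

end Summit.Ventures.YMGap.KernelTransfer

end
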